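/-
Copyright: the b2b-balaban T⁴-continuum CRUX team, row NE7b OWNER lineage `t4-ne7b-p1` (gen 121). Project licence.
-/
import Summits.QuantumFields.BalabanUV.T4Continuum.Spine.NE7b.SupTorusCovarianceLocality
import Summits.QuantumFields.BalabanUV.T4Continuum.Spine.NE7b.SupTorusPropagatorModulus

/-!
# THE NEXT-SCALE HESSIAN OF THE TORUS ROAD IS LIPSCHITZ IN THE BACKGROUND POTENTIAL, COARSE-LOCALLY — MESH- AND VOLUME-FREE: for two
# potentials `V₁, V₂ ≥ −λ` with `|V₁ − V₂| ≤ D` pointwise, the Schur complements `T_i = Q′tH_{V_i}⁻¹Q′t*` of the block columns and their inverses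
# (the road's next-scale Hessians `(n+1)^dT_i⁻¹`) satisfy `|T₁(y,y′) − T₂(y,y′)|, |T₁⁻¹(y,y′) − T₂⁻¹(y,y′)| ≤ C·D·e^{−δρ_s(y,y′)}` — given the coarse
# floors, and UNCONDITIONALLY on the two-sided class, `(C, δ)` from `(d, a, λ, Λ)` only (row NE7b, node U5c; (131)–(141) BY NAME; [folklore])

Cell `pub-balaban`, sub-cell `t4`, spine estimate NE7b (`T4WeightBudget.RelWeightBound`; the cell's OWN estimate — NOT PRINTED in
[Bałaban 1983–89], NOT PROVED).  Crux-route work under `Spine/NE7b/` by the row OWNER (`t4-ne7b-p1` gen 121, file (142)) under FREEZE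
(0)'s crux-prover clause — the coarse half of the regularity-in-the-background of the locality column ((141) did `H⁻¹`); NOTHING of
Bałaban's is named as a Lean object, valued or asserted; no `T4Continuum/Support` leaf typed; no `def`, no notation (both families of block
columns enter through their displayed equations; `T_i⁻¹` is Mathlib's inverse of `Matrix.of T_i`); zero `sorry`.  Imports (BY NAME): the
OWNER's (141) `…SupTorusPropagatorModulus` (`blockSq_sub_le_of_potentials`), (139) `…SupTorusCovarianceLocality`
(`det_isUnit_of_floor`; through it (138) `coarse_convolution_le`, (137) `rate_mono`, (135) `coarse_floor`, (134) `schur_inverse_decay`, (133)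
`sum_indicator_mul`, (131) `exists_rate`), Mathlib's `Matrix.inv_sub_inv`.

WHY (located).  The effective action's Hessian at the next scale is `W″(φ) = (n+1)^dT(φ)⁻¹`, `T(φ) = Q′t(At + diag(u″∘φ))⁻¹Q′t*` ((100)∕(102),
(136)); its continuity in the background `φ` — through `V = u″∘φ` — is what makes the next-scale action `C²` with LOCAL control of the modulus.
(141) gives `H_{V₁}⁻¹ − H_{V₂}⁻¹` block-to-block of size `D = sup|V₁ − V₂|`; on the block indicator source (`Σ𝟙² = (n+1)^d`) this is the
block `ℓ²` distance of the columns `ψ¹_{y′} − ψ²_{y′}`, and block Cauchy–Schwarz cancels the block volume exactly: `|T₁ − T₂|(y,y′) ≤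
√(const)·D·e^{−(κ∕2)ρ_s}`.  For the inverses, `T₁⁻¹ − T₂⁻¹ = T₁⁻¹(T₂ − T₁)T₂⁻¹` (both invertible by the floors, (139) `det_isUnit_of_floor`),
and (134)'s decay of `T_i⁻¹` with two coarse convolutions ((138), rates `δa = min(κ∕2, δ₁∕2)`, `δb = δa∕2`) gives the same shape.

WHAT IS PROVED ([folklore]; fine torus `Site d ((n+1)s)`, coarse `Site d s`, `[NeZero s]`; both actions DISPLAYED; `bt x = σ_s(blk n (wm x))`;
`T_i(y,y′) = (n+1)^{−d}Σ_z ψ^i_{y′}(σ(chart (wm y) z))`, `H_{V_i}ψ^i_{y′} = 𝟙[bt · = y′]`; `m_κ = min(2,a) − λ − 2dκ² − a(e^{2dκ} − 1)`; `K_α = (2∕(1 −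
e^{−α}))^d`; `ρ_s` = (132)'s distance written out):
* §1 `sum_indicator_sq` (`Σ_x 𝟙[bt x = y′]² = (n+1)^d`), **`column_sub_blockSq_le`** (`Σ_z (ψ¹ − ψ²)_{y′}(σ(chart (wm y) z))² ≤
  m_{κ∕2}⁻²(D²m_κ⁻²e^{4dκ}(n+1)^d·e^{dκ}K_κ)e^{dκ}e^{−κρ_s(y,y′)}`), **`schur_sub_le`** (`|T₁(y,y′) − T₂(y,y′)| ≤ √(m_{κ∕2}⁻²m_κ⁻²e^{6dκ}K_κ)·D·
  e^{−(κ∕2)ρ_s(y,y′)}` — mesh-free).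
* §2 **`nextScale_hessian_lipschitz_of_floor`** (`a ≥ 0`, `λ < min(2,a)`, `γ > 0`: `∃ C δ > 0` such that for ALL `n, s`, `V₁, V₂ ≥ −λ` with
  `|V₁ − V₂| ≤ D`, block columns with the floors `γΣg² ≤ ⟨g,T_ig⟩`: (i) `|T₁ − T₂|(y,y′) ≤ CDe^{−δρ_s}`, (ii) `|T₁⁻¹ − T₂⁻¹|(y,y′) ≤ CDe^{−δρ_s}`),
  THE HEADLINE **`nextScale_hessian_lipschitz`** (the same UNCONDITIONALLY on the two-sided class `−λ ≤ V_i ≤ Λ`, `a > 0`; constants from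
  `(d, a, λ, Λ)` only).
* §3 toy.

HONEST (what this is NOT).  Lipschitz (first order) in the sup distance of the potentials; the response and the covariance inherit the
modulus by the same algebra ((137)∕(139) twice — not typed); the block-average class version is three lines from (140) (not typed);
`W″ = (n+1)^dT⁻¹` is the road's identification ((102)∕(136)), not re-proved; constants explicit, far from sharp; cubic periods; scalar
skeleton ((A3), NC-NE7b-α UNRULED); nothing of the covariant propagators; nothing of Bałaban's.  BY-NAME EFFECT ON THE WALL: NONE.  NE7b
NOT PRINTED ∕ NOT PROVED; spine PROVED 0∕9; rung (B)+1 on a FINITE torus — NOT infinite volume, NOT the mass gap, NOT Clay.  HONEST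
DEPENDENCY: continuum YM on T⁴ ⇐ BetaPertH ∧ nine spine estimates (0∕9 proved); BetaPertH ⇐ (D1) ∧ (D4) ∧ CAP+tail; G-an2-4 gates asym,
D1 and NE2∕3∕4.
-/

set_option autoImplicit false

noncomputable section

namespace Summit.QuantumFields.BalabanUV.T4Continuum.NE7b.SupTorusNextScaleModulus

open Real
open Literature.MathematicalPhysics.QuantumFieldTheory.Balaban1983to89
open B6QGQLower276 (X e blk B side chart mem_B sum_B sum_B_const card_cube blk_chart)
open Beta (Site siteOf windowMap siteOf_windowMap siteOf_add)
open SupTorusHessianCombesThomas (exists_rate)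
open SupTorusActionForm (sum_indicator_mul)
open SupTorusSchurComplement (schur_inverse_decay)
open SupTorusCoarseFloor (coarse_floor)
open SupTorusResponseLocality (rate_mono)
open SupTorusPropagatorLocality (coarse_convolution_le)
open SupTorusCovarianceLocality (det_isUnit_of_floor)
open SupTorusPropagatorModulus (blockSq_sub_le_of_potentials)

variable {d : ℕ}

/-! ## §1. Two potentials: the Schur complement is Lipschitz in `V`, coarse-locally -/

section Schur

variable (n : ℕ) (a : ℝ) (s : ℕ) [NeZero s] (ha : 0 ≤ a) {lam κ D : ℝ} (hκ0 : 0 < κ) (hκ1 : κ ≤ 1)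
  (hm : 0 < min 2 a - lam - 2 * d * κ ^ 2 - a * (exp (2 * d * κ) - 1))
  (V₁ V₂ : Site d ((n + 1) * s) → ℝ) (hV₁ : ∀ x, -lam ≤ V₁ x) (hV₂ : ∀ x, -lam ≤ V₂ x) (hD : ∀ x, |V₁ x - V₂ x| ≤ D)
  (ψ₁ ψ₂ : Site d s → Site d ((n + 1) * s) → ℝ)
  (hψ₁ : ∀ y' x, ((n : ℝ) + 1) ^ 2 * ∑ μ, (2 * ψ₁ y' x - ψ₁ y' (x + siteOf d ((n + 1) * s) (e μ)) - ψ₁ y' (x - siteOf d ((n + 1) * s) (e μ)))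
      + a / ((n : ℝ) + 1) ^ d * ∑ q ∈ B n (blk n (windowMap d ((n + 1) * s) x)), ψ₁ y' (siteOf d ((n + 1) * s) q) + V₁ x * ψ₁ y' x
      = if siteOf d s (blk n (windowMap d ((n + 1) * s) x)) = y' then 1 else 0)
  (hψ₂ : ∀ y' x, ((n : ℝ) + 1) ^ 2 * ∑ μ, (2 * ψ₂ y' x - ψ₂ y' (x + siteOf d ((n + 1) * s) (e μ)) - ψ₂ y' (x - siteOf d ((n + 1) * s) (e μ)))
      + a / ((n : ℝ) + 1) ^ d * ∑ q ∈ B n (blk n (windowMap d ((n + 1) * s) x)), ψ₂ y' (siteOf d ((n + 1) * s) q) + V₂ x * ψ₂ y' x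
      = if siteOf d s (blk n (windowMap d ((n + 1) * s) x)) = y' then 1 else 0)

omit [NeZero s] in
/-- The block indicator has `Σ_x 𝟙[bt x = y′]² = (n+1)^d`. [folklore] -/
theorem sum_indicator_sq [NeZero s] (y' : Site d s) :
    ∑ x : Site d ((n + 1) * s), (if siteOf d s (blk n (windowMap d ((n + 1) * s) x)) = y' then (1 : ℝ) else 0) ^ 2 = ((n : ℝ) + 1) ^ d := by
  classical
  have h := sum_indicator_mul n s y' (fun _ => (1 : ℝ))
  simp only [mul_one] at h
  rw [show ∑ x : Site d ((n + 1) * s), (if siteOf d s (blk n (windowMap d ((n + 1) * s) x)) = y' then (1 : ℝ) else 0) ^ 2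
      = ∑ x : Site d ((n + 1) * s), (if siteOf d s (blk n (windowMap d ((n + 1) * s) x)) = y' then (1 : ℝ) else 0) from
      Finset.sum_congr rfl fun x _ => by split_ifs <;> norm_num, h, Finset.sum_const, Finset.card_univ, nsmul_eq_mul, card_cube, mul_one]

include ha hκ0 hκ1 hm hV₁ hV₂ hD hψ₁ hψ₂ in
/-- **THE BLOCK COLUMNS ARE LIPSCHITZ IN THE POTENTIAL**: `Σ_z (ψ₁ − ψ₂)_{y′}(σ(chart (wm y) z))² ≤ m_{κ∕2}⁻²(D²m_κ⁻²e^{4dκ}(n+1)^d·e^{dκ}K_κ)e^{dκ}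
e^{−κρ_s(y,y′)}` — (141) `blockSq_sub_le_of_potentials` on the block indicator source (`Σ𝟙² = (n+1)^d`). [folklore] -/
theorem column_sub_blockSq_le (y y' : Site d s) :
    ∑ z : Fin d → Fin (n + 1), (ψ₁ y' (siteOf d ((n + 1) * s) (chart n (windowMap d s y) z))
        - ψ₂ y' (siteOf d ((n + 1) * s) (chart n (windowMap d s y) z))) ^ 2
      ≤ ((min 2 a - lam - 2 * d * (κ / 2) ^ 2 - a * (exp (2 * d * (κ / 2)) - 1))⁻¹) ^ 2
          * ((D ^ 2 * (((min 2 a - lam - 2 * d * κ ^ 2 - a * (exp (2 * d * κ) - 1))⁻¹) ^ 2 * exp (4 * d * κ) * ((n : ℝ) + 1) ^ d))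
            * exp (2 * d * (κ / 2)) * (2 * (1 - exp (-(2 * (κ / 2))))⁻¹) ^ d) * exp (2 * d * (κ / 2))
        * exp (-(2 * (κ / 2) * ∑ i, (((y i - y' i).valMinAbs.natAbs : ℕ) : ℝ))) := by
  classical
  have h := blockSq_sub_le_of_potentials n a s ha hκ0 hκ1 hm V₁ V₂ hV₁ hV₂ hD y' (ψ₁ y') (ψ₂ y')
    (fun x => if siteOf d s (blk n (windowMap d ((n + 1) * s) x)) = y' then 1 else 0) (fun x hx => if_neg hx) (hψ₁ y') (hψ₂ y') y
  rwa [sum_indicator_sq n s y'] at h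

include ha hκ0 hκ1 hm hV₁ hV₂ hD hψ₁ hψ₂ in
/-- **THE SCHUR COMPLEMENT IS LIPSCHITZ IN THE POTENTIAL, COARSE-LOCALLY, MESH-FREE**:
`|T₁(y,y′) − T₂(y,y′)| ≤ √(m_{κ∕2}⁻²m_κ⁻²e^{6dκ}K_κ)·D·e^{−(κ∕2)ρ_s(y,y′)}` for `T_i(y,y′) = (n+1)^{−d}Σ_z ψ^i_{y′}(σ(chart (wm y) z))` — block
Cauchy–Schwarz on `column_sub_blockSq_le`: the block volume cancels exactly. [folklore] -/
theorem schur_sub_le (y y' : Site d s) :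
    |(((n : ℝ) + 1) ^ d)⁻¹ * ∑ z : Fin d → Fin (n + 1), ψ₁ y' (siteOf d ((n + 1) * s) (chart n (windowMap d s y) z))
        - (((n : ℝ) + 1) ^ d)⁻¹ * ∑ z : Fin d → Fin (n + 1), ψ₂ y' (siteOf d ((n + 1) * s) (chart n (windowMap d s y) z))|
      ≤ √(((min 2 a - lam - 2 * d * (κ / 2) ^ 2 - a * (exp (2 * d * (κ / 2)) - 1))⁻¹) ^ 2
            * ((min 2 a - lam - 2 * d * κ ^ 2 - a * (exp (2 * d * κ) - 1))⁻¹) ^ 2 * exp (4 * d * κ) * exp (2 * d * (κ / 2))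
            * (2 * (1 - exp (-(2 * (κ / 2))))⁻¹) ^ d * exp (2 * d * (κ / 2)))
          * D * exp (-((κ / 2) * ∑ i, (((y i - y' i).valMinAbs.natAbs : ℕ) : ℝ))) := by
  classical
  have hvol : (0 : ℝ) < ((n : ℝ) + 1) ^ d := by positivity
  have hD0 : 0 ≤ D := (abs_nonneg _).trans (hD (siteOf d ((n + 1) * s) (chart n (windowMap d s y) 0)))
  have hcol := column_sub_blockSq_le n a s ha hκ0 hκ1 hm V₁ V₂ hV₁ hV₂ hD ψ₁ ψ₂ hψ₁ hψ₂ y y'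
  set Cst : ℝ := ((min 2 a - lam - 2 * d * (κ / 2) ^ 2 - a * (exp (2 * d * (κ / 2)) - 1))⁻¹) ^ 2
      * ((min 2 a - lam - 2 * d * κ ^ 2 - a * (exp (2 * d * κ) - 1))⁻¹) ^ 2 * exp (4 * d * κ) * exp (2 * d * (κ / 2))
      * (2 * (1 - exp (-(2 * (κ / 2))))⁻¹) ^ d * exp (2 * d * (κ / 2)) with hCst
  have hK0 : 0 ≤ (2 * (1 - exp (-(2 * (κ / 2))))⁻¹) ^ d :=
    pow_nonneg (mul_nonneg zero_le_two (inv_nonneg.2 (sub_nonneg.2 (exp_le_one_iff.2 (by linarith))))) d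
  have hCst0 : 0 ≤ Cst := by positivity
  -- Cauchy–Schwarz on the block
  have hCS := sq_sum_le_card_mul_sum_sq (s := (Finset.univ : Finset (Fin d → Fin (n + 1))))
    (f := fun z => ψ₁ y' (siteOf d ((n + 1) * s) (chart n (windowMap d s y) z)) - ψ₂ y' (siteOf d ((n + 1) * s) (chart n (windowMap d s y) z)))
  rw [Finset.card_univ, card_cube] at hCS
  rw [← mul_sub, ← Finset.sum_sub_distrib]
  have hR : 0 ≤ √Cst * D * exp (-((κ / 2) * ∑ i, (((y i - y' i).valMinAbs.natAbs : ℕ) : ℝ))) := by positivity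
  have hsq : ((((n : ℝ) + 1) ^ d)⁻¹ * ∑ z : Fin d → Fin (n + 1), (ψ₁ y' (siteOf d ((n + 1) * s) (chart n (windowMap d s y) z))
        - ψ₂ y' (siteOf d ((n + 1) * s) (chart n (windowMap d s y) z)))) ^ 2
      ≤ (√Cst * D * exp (-((κ / 2) * ∑ i, (((y i - y' i).valMinAbs.natAbs : ℕ) : ℝ)))) ^ 2 := by
    have h2 : exp (-(2 * (κ / 2) * ∑ i, (((y i - y' i).valMinAbs.natAbs : ℕ) : ℝ)))
        = exp (-((κ / 2) * ∑ i, (((y i - y' i).valMinAbs.natAbs : ℕ) : ℝ))) ^ 2 := by rw [sq, ← exp_add]; ring_nf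
    simp only [mul_pow, Real.sq_sqrt hCst0]
    calc (((n : ℝ) + 1) ^ d)⁻¹ ^ 2 * (∑ z : Fin d → Fin (n + 1), (ψ₁ y' (siteOf d ((n + 1) * s) (chart n (windowMap d s y) z))
            - ψ₂ y' (siteOf d ((n + 1) * s) (chart n (windowMap d s y) z)))) ^ 2
        ≤ (((n : ℝ) + 1) ^ d)⁻¹ ^ 2 * (((n : ℝ) + 1) ^ d * ∑ z : Fin d → Fin (n + 1), (ψ₁ y' (siteOf d ((n + 1) * s) (chart n (windowMap d s y) z))
            - ψ₂ y' (siteOf d ((n + 1) * s) (chart n (windowMap d s y) z))) ^ 2) := mul_le_mul_of_nonneg_left hCS (sq_nonneg _)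
      _ ≤ (((n : ℝ) + 1) ^ d)⁻¹ ^ 2 * (((n : ℝ) + 1) ^ d * (((min 2 a - lam - 2 * d * (κ / 2) ^ 2 - a * (exp (2 * d * (κ / 2)) - 1))⁻¹) ^ 2
          * ((D ^ 2 * (((min 2 a - lam - 2 * d * κ ^ 2 - a * (exp (2 * d * κ) - 1))⁻¹) ^ 2 * exp (4 * d * κ) * ((n : ℝ) + 1) ^ d))
            * exp (2 * d * (κ / 2)) * (2 * (1 - exp (-(2 * (κ / 2))))⁻¹) ^ d) * exp (2 * d * (κ / 2))
          * exp (-(2 * (κ / 2) * ∑ i, (((y i - y' i).valMinAbs.natAbs : ℕ) : ℝ))))) :=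
          mul_le_mul_of_nonneg_left (mul_le_mul_of_nonneg_left hcol hvol.le) (sq_nonneg _)
      _ = Cst * D ^ 2 * exp (-((κ / 2) * ∑ i, (((y i - y' i).valMinAbs.natAbs : ℕ) : ℝ))) ^ 2 := by
          rw [h2, hCst]; field_simp
  exact abs_le.2 (abs_le_of_sq_le_sq' hsq hR)

end Schur

/-! ## §2. Two potentials with coarse floors: the inverse Schur complements (next-scale Hessians) are Lipschitz in `V`, coarse-locally -/

/-- **THE NEXT-SCALE HESSIAN IS LIPSCHITZ IN THE BACKGROUND POTENTIAL — GIVEN THE COARSE FLOORS.**  Fix `d`, `a ≥ 0`, `λ < min(2,a)` and a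
floor `γ > 0`.  THERE ARE `C, δ > 0` (functions of these only) such that for ALL `n, s`, ALL `V₁, V₂ ≥ −λ` with `|V₁ − V₂| ≤ D` pointwise,
ALL block columns `ψ^i` (`H_{V_i}ψ^i_{y′} = 𝟙[bt · = y′]`) whose Schur complements `T_i` both have the floor `γΣg² ≤ ⟨g,T_ig⟩`, and every
`y, y′`: (i) `|T₁(y,y′) − T₂(y,y′)| ≤ C·D·e^{−δρ_s(y,y′)}`; (ii) `|T₁⁻¹(y,y′) − T₂⁻¹(y,y′)| ≤ C·D·e^{−δρ_s(y,y′)}` — `T⁻¹` Mathlib's inverse of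
`Matrix.of T`; `T₁⁻¹ − T₂⁻¹ = T₁⁻¹(T₂ − T₁)T₂⁻¹` (Mathlib `Matrix.inv_sub_inv`) and two coarse convolutions ((138) `coarse_convolution_le`) of
§1 with (134) `schur_inverse_decay`. [folklore] -/
theorem nextScale_hessian_lipschitz_of_floor (a : ℝ) (ha : 0 ≤ a) {lam γ : ℝ} (hm0 : 0 < min 2 a - lam) (hγ : 0 < γ) :
    ∃ C δ : ℝ, 0 < C ∧ 0 < δ ∧ ∀ (n s : ℕ) [NeZero s] (V₁ V₂ : Site d ((n + 1) * s) → ℝ), (∀ x, -lam ≤ V₁ x) → (∀ x, -lam ≤ V₂ x) →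
      ∀ D : ℝ, (∀ x, |V₁ x - V₂ x| ≤ D) →
      ∀ ψ₁ ψ₂ : Site d s → Site d ((n + 1) * s) → ℝ,
      (∀ y' x, ((n : ℝ) + 1) ^ 2 * ∑ μ, (2 * ψ₁ y' x - ψ₁ y' (x + siteOf d ((n + 1) * s) (e μ)) - ψ₁ y' (x - siteOf d ((n + 1) * s) (e μ)))
        + a / ((n : ℝ) + 1) ^ d * ∑ q ∈ B n (blk n (windowMap d ((n + 1) * s) x)), ψ₁ y' (siteOf d ((n + 1) * s) q) + V₁ x * ψ₁ y' x
        = if siteOf d s (blk n (windowMap d ((n + 1) * s) x)) = y' then 1 else 0) →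
      (∀ y' x, ((n : ℝ) + 1) ^ 2 * ∑ μ, (2 * ψ₂ y' x - ψ₂ y' (x + siteOf d ((n + 1) * s) (e μ)) - ψ₂ y' (x - siteOf d ((n + 1) * s) (e μ)))
        + a / ((n : ℝ) + 1) ^ d * ∑ q ∈ B n (blk n (windowMap d ((n + 1) * s) x)), ψ₂ y' (siteOf d ((n + 1) * s) q) + V₂ x * ψ₂ y' x
        = if siteOf d s (blk n (windowMap d ((n + 1) * s) x)) = y' then 1 else 0) →
      (∀ g : Site d s → ℝ, γ * ∑ y, g y ^ 2
        ≤ ∑ y, g y * ∑ y', ((((n : ℝ) + 1) ^ d)⁻¹ * ∑ z : Fin d → Fin (n + 1), ψ₁ y' (siteOf d ((n + 1) * s) (chart n (windowMap d s y) z))) * g y') →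
      (∀ g : Site d s → ℝ, γ * ∑ y, g y ^ 2
        ≤ ∑ y, g y * ∑ y', ((((n : ℝ) + 1) ^ d)⁻¹ * ∑ z : Fin d → Fin (n + 1), ψ₂ y' (siteOf d ((n + 1) * s) (chart n (windowMap d s y) z))) * g y') →
      ∀ y y' : Site d s,
        |(((n : ℝ) + 1) ^ d)⁻¹ * ∑ z : Fin d → Fin (n + 1), ψ₁ y' (siteOf d ((n + 1) * s) (chart n (windowMap d s y) z))
            - (((n : ℝ) + 1) ^ d)⁻¹ * ∑ z : Fin d → Fin (n + 1), ψ₂ y' (siteOf d ((n + 1) * s) (chart n (windowMap d s y) z))|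
          ≤ C * D * exp (-(δ * ∑ i, (((y i - y' i).valMinAbs.natAbs : ℕ) : ℝ))) ∧
        |(Matrix.of fun y y' : Site d s =>
            (((n : ℝ) + 1) ^ d)⁻¹ * ∑ z : Fin d → Fin (n + 1), ψ₁ y' (siteOf d ((n + 1) * s) (chart n (windowMap d s y) z)))⁻¹ y y'
          - (Matrix.of fun y y' : Site d s =>
            (((n : ℝ) + 1) ^ d)⁻¹ * ∑ z : Fin d → Fin (n + 1), ψ₂ y' (siteOf d ((n + 1) * s) (chart n (windowMap d s y) z)))⁻¹ y y'|
          ≤ C * D * exp (-(δ * ∑ i, (((y i - y' i).valMinAbs.natAbs : ℕ) : ℝ))) := by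
  classical
  have hd : (0 : ℝ) ≤ d := Nat.cast_nonneg d
  -- rates: `κ` from (131), `(c₁, δ₁)` from (134) at the floor `γ`; `δa = min(κ∕2, δ₁∕2)` for the inner convolution, `δb = δa∕2` for the outer
  obtain ⟨κ, hκ0, hκ1, hκm⟩ := exists_rate (d := d) a ha hm0
  have hm : 0 < min 2 a - lam - 2 * d * κ ^ 2 - a * (exp (2 * d * κ) - 1) := by linarith
  obtain ⟨c₁, δ₁, hc₁, hδ₁, H134⟩ := schur_inverse_decay (d := d) a ha hκ0 hκ1 hm hγ
  set Cst : ℝ := ((min 2 a - lam - 2 * d * (κ / 2) ^ 2 - a * (exp (2 * d * (κ / 2)) - 1))⁻¹) ^ 2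
      * ((min 2 a - lam - 2 * d * κ ^ 2 - a * (exp (2 * d * κ) - 1))⁻¹) ^ 2 * exp (4 * d * κ) * exp (2 * d * (κ / 2))
      * (2 * (1 - exp (-(2 * (κ / 2))))⁻¹) ^ d * exp (2 * d * (κ / 2)) with hCst
  set δa : ℝ := min (κ / 2) (δ₁ / 2) with hδa
  have hδa0 : 0 < δa := lt_min (by linarith) (by linarith)
  have hδaκ : δa ≤ κ / 2 := min_le_left _ _
  have h2δa : 2 * δa ≤ δ₁ := by have := min_le_right (κ / 2) (δ₁ / 2); rw [← hδa] at this; linarith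
  set δb : ℝ := δa / 2 with hδb
  have hδb0 : 0 < δb := by rw [hδb]; linarith
  have hδbδ₁ : δb ≤ δ₁ := by rw [hδb]; linarith
  have h2δb : 2 * δb ≤ δa := by rw [hδb]; linarith
  set Ka : ℝ := (2 * (1 - exp (-δa))⁻¹) ^ d with hKa
  set Kb : ℝ := (2 * (1 - exp (-δb))⁻¹) ^ d with hKb
  have hKa0 : 0 ≤ Ka := pow_nonneg (mul_nonneg zero_le_two (inv_nonneg.2 (sub_nonneg.2 (exp_le_one_iff.2 (by linarith))))) d
  have hKb0 : 0 ≤ Kb := pow_nonneg (mul_nonneg zero_le_two (inv_nonneg.2 (sub_nonneg.2 (exp_le_one_iff.2 (by linarith))))) d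
  refine ⟨√Cst + c₁ * (√Cst * c₁ * Ka) * Kb + 1, δb, by positivity, hδb0, ?_⟩
  intro n s _ V₁ V₂ hV₁ hV₂ D hD ψ₁ ψ₂ hψ₁ hψ₂ hfl₁ hfl₂ y y'
  set T₁ : Matrix (Site d s) (Site d s) ℝ := Matrix.of fun yy y'' : Site d s =>
    (((n : ℝ) + 1) ^ d)⁻¹ * ∑ z : Fin d → Fin (n + 1), ψ₁ y'' (siteOf d ((n + 1) * s) (chart n (windowMap d s yy) z)) with hT₁
  set T₂ : Matrix (Site d s) (Site d s) ℝ := Matrix.of fun yy y'' : Site d s =>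
    (((n : ℝ) + 1) ^ d)⁻¹ * ∑ z : Fin d → Fin (n + 1), ψ₂ y'' (siteOf d ((n + 1) * s) (chart n (windowMap d s yy) z)) with hT₂
  have hD0 : 0 ≤ D := (abs_nonneg _).trans (hD (siteOf d ((n + 1) * s) (chart n (windowMap d s y) 0)))
  have hρ0 : 0 ≤ ∑ i, (((y i - y' i).valMinAbs.natAbs : ℕ) : ℝ) := Finset.sum_nonneg fun _ _ => Nat.cast_nonneg _
  -- (i) the Schur complements, at the rate `κ∕2 ≥ δb`
  have hT : ∀ yy y'' : Site d s, |T₁ yy y'' - T₂ yy y''| ≤ √Cst * D * exp (-((κ / 2) * ∑ i, (((yy i - y'' i).valMinAbs.natAbs : ℕ) : ℝ))) :=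
    fun yy y'' => by
      simpa only [hT₁, hT₂, Matrix.of_apply] using schur_sub_le n a s ha hκ0 hκ1 hm V₁ V₂ hV₁ hV₂ hD ψ₁ ψ₂ hψ₁ hψ₂ yy y''
  have hδbκ : δb ≤ κ / 2 := by linarith
  refine ⟨?_, ?_⟩
  · have h1 := hT y y'
    simp only [hT₁, hT₂, Matrix.of_apply] at h1
    refine h1.trans ?_
    have hexp : exp (-((κ / 2) * ∑ i, (((y i - y' i).valMinAbs.natAbs : ℕ) : ℝ)))
        ≤ exp (-(δb * ∑ i, (((y i - y' i).valMinAbs.natAbs : ℕ) : ℝ))) :=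
      exp_le_exp.2 (by nlinarith [mul_le_mul_of_nonneg_right hδbκ hρ0])
    have hP : 0 ≤ c₁ * (√Cst * c₁ * Ka) * Kb := by positivity
    have hc : √Cst * D ≤ (√Cst + c₁ * (√Cst * c₁ * Ka) * Kb + 1) * D := mul_le_mul_of_nonneg_right (by linarith) hD0
    exact mul_le_mul hc hexp (exp_pos _).le (by positivity)
  · -- (ii) the inverses: `T₁⁻¹ − T₂⁻¹ = T₁⁻¹(T₂ − T₁)T₂⁻¹`
    have hu₁ : IsUnit T₁.det := det_isUnit_of_floor T₁ hγ fun g => by simpa only [hT₁, Matrix.of_apply] using hfl₁ g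
    have hu₂ : IsUnit T₂.det := det_isUnit_of_floor T₂ hγ fun g => by simpa only [hT₂, Matrix.of_apply] using hfl₂ g
    have hinv : T₁⁻¹ - T₂⁻¹ = T₁⁻¹ * (T₂ - T₁) * T₂⁻¹ :=
      Matrix.inv_sub_inv (by rw [Matrix.isUnit_iff_isUnit_det, Matrix.isUnit_iff_isUnit_det]; exact ⟨fun _ => hu₂, fun _ => hu₁⟩)
    have hentry : T₁⁻¹ y y' - T₂⁻¹ y y' = ∑ y'', T₁⁻¹ y y'' * ∑ y''', (T₂ y'' y''' - T₁ y'' y''') * T₂⁻¹ y''' y' := by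
      have h := congrFun (congrFun hinv y) y'
      rw [Matrix.mul_assoc, Matrix.sub_apply, Matrix.mul_apply] at h
      rw [h]
      refine Finset.sum_congr rfl fun y'' _ => ?_
      rw [Matrix.mul_apply]
      simp only [Matrix.sub_apply]
    have hI₁ : ∀ yy y'' : Site d s, |T₁⁻¹ yy y''| ≤ c₁ * exp (-(δ₁ * ∑ i, (((yy i - y'' i).valMinAbs.natAbs : ℕ) : ℝ))) :=
      fun yy y'' => H134 n s V₁ hV₁ ψ₁ hψ₁ hfl₁ yy y''
    have hI₂ : ∀ yy y'' : Site d s, |T₂⁻¹ yy y''| ≤ c₁ * exp (-(δ₁ * ∑ i, (((yy i - y'' i).valMinAbs.natAbs : ℕ) : ℝ))) :=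
      fun yy y'' => H134 n s V₂ hV₂ ψ₂ hψ₂ hfl₂ yy y''
    -- inner convolution: rate `δa` (`δa ≤ κ∕2`, `2δa ≤ δ₁`)
    have hinner : ∀ y'' : Site d s, |∑ y''', (T₂ y'' y''' - T₁ y'' y''') * T₂⁻¹ y''' y'|
        ≤ √Cst * D * c₁ * Ka * exp (-(δa * ∑ i, (((y'' i - y' i).valMinAbs.natAbs : ℕ) : ℝ))) := fun y'' =>
      coarse_convolution_le s hδa0 hδaκ h2δa (by positivity) hc₁.le y'' y' (fun y''' => T₂ y'' y''' - T₁ y'' y''')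
        (fun y''' => T₂⁻¹ y''' y') (fun y''' => by rw [abs_sub_comm]; exact hT y'' y''') (fun y''' => hI₂ y''' y')
    -- outer convolution: rate `δb` (`δb ≤ δ₁`, `2δb ≤ δa`)
    have houter := coarse_convolution_le s hδb0 hδbδ₁ h2δb hc₁.le (by positivity : 0 ≤ √Cst * D * c₁ * Ka) y y'
      (fun y'' => T₁⁻¹ y y'') (fun y'' => ∑ y''', (T₂ y'' y''' - T₁ y'' y''') * T₂⁻¹ y''' y') (fun y'' => hI₁ y y'') hinner
    rw [hentry]
    refine houter.trans ?_
    have hE0 : 0 ≤ exp (-(δb * ∑ i, (((y i - y' i).valMinAbs.natAbs : ℕ) : ℝ))) := (exp_pos _).le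
    have hc : c₁ * (√Cst * D * c₁ * Ka) * Kb ≤ (√Cst + c₁ * (√Cst * c₁ * Ka) * Kb + 1) * D := by
      have e1 : c₁ * (√Cst * D * c₁ * Ka) * Kb = (c₁ * (√Cst * c₁ * Ka) * Kb) * D := by ring
      rw [e1]
      exact mul_le_mul_of_nonneg_right (by nlinarith [Real.sqrt_nonneg Cst]) hD0
    exact mul_le_mul_of_nonneg_right hc hE0

/-- **HEADLINE — ON THE TWO-SIDED CLASS `−λ ≤ V₁, V₂ ≤ Λ` THE NEXT-SCALE HESSIAN IS LIPSCHITZ IN THE BACKGROUND, UNCONDITIONALLY**: for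
`a > 0`, `λ < min(2,a)`, `Λ ≥ 0` there are `C, δ > 0` from `(d, a, λ, Λ)` only with (i)–(ii) of `nextScale_hessian_lipschitz_of_floor` for all
`n, s`, all such `V₁, V₂` with `|V₁ − V₂| ≤ D` and their block columns — the floors are (135) `coarse_floor`. [folklore] -/
theorem nextScale_hessian_lipschitz (a : ℝ) (ha : 0 < a) {lam Lam : ℝ} (hm0 : 0 < min 2 a - lam) (hLam : 0 ≤ Lam) :
    ∃ C δ : ℝ, 0 < C ∧ 0 < δ ∧ ∀ (n s : ℕ) [NeZero s] (V₁ V₂ : Site d ((n + 1) * s) → ℝ), (∀ x, -lam ≤ V₁ x) → (∀ x, -lam ≤ V₂ x) →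
      (∀ x, V₁ x ≤ Lam) → (∀ x, V₂ x ≤ Lam) → ∀ D : ℝ, (∀ x, |V₁ x - V₂ x| ≤ D) →
      ∀ ψ₁ ψ₂ : Site d s → Site d ((n + 1) * s) → ℝ,
      (∀ y' x, ((n : ℝ) + 1) ^ 2 * ∑ μ, (2 * ψ₁ y' x - ψ₁ y' (x + siteOf d ((n + 1) * s) (e μ)) - ψ₁ y' (x - siteOf d ((n + 1) * s) (e μ)))
        + a / ((n : ℝ) + 1) ^ d * ∑ q ∈ B n (blk n (windowMap d ((n + 1) * s) x)), ψ₁ y' (siteOf d ((n + 1) * s) q) + V₁ x * ψ₁ y' x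
        = if siteOf d s (blk n (windowMap d ((n + 1) * s) x)) = y' then 1 else 0) →
      (∀ y' x, ((n : ℝ) + 1) ^ 2 * ∑ μ, (2 * ψ₂ y' x - ψ₂ y' (x + siteOf d ((n + 1) * s) (e μ)) - ψ₂ y' (x - siteOf d ((n + 1) * s) (e μ)))
        + a / ((n : ℝ) + 1) ^ d * ∑ q ∈ B n (blk n (windowMap d ((n + 1) * s) x)), ψ₂ y' (siteOf d ((n + 1) * s) q) + V₂ x * ψ₂ y' x
        = if siteOf d s (blk n (windowMap d ((n + 1) * s) x)) = y' then 1 else 0) →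
      ∀ y y' : Site d s,
        |(((n : ℝ) + 1) ^ d)⁻¹ * ∑ z : Fin d → Fin (n + 1), ψ₁ y' (siteOf d ((n + 1) * s) (chart n (windowMap d s y) z))
            - (((n : ℝ) + 1) ^ d)⁻¹ * ∑ z : Fin d → Fin (n + 1), ψ₂ y' (siteOf d ((n + 1) * s) (chart n (windowMap d s y) z))|
          ≤ C * D * exp (-(δ * ∑ i, (((y i - y' i).valMinAbs.natAbs : ℕ) : ℝ))) ∧
        |(Matrix.of fun y y' : Site d s =>
            (((n : ℝ) + 1) ^ d)⁻¹ * ∑ z : Fin d → Fin (n + 1), ψ₁ y' (siteOf d ((n + 1) * s) (chart n (windowMap d s y) z)))⁻¹ y y'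
          - (Matrix.of fun y y' : Site d s =>
            (((n : ℝ) + 1) ^ d)⁻¹ * ∑ z : Fin d → Fin (n + 1), ψ₂ y' (siteOf d ((n + 1) * s) (chart n (windowMap d s y) z)))⁻¹ y y'|
          ≤ C * D * exp (-(δ * ∑ i, (((y i - y' i).valMinAbs.natAbs : ℕ) : ℝ))) := by
  have hd : (0 : ℝ) ≤ d := Nat.cast_nonneg d
  have hγ : 0 < 1 / ((36 : ℝ) ^ d * (4 * d + a + Lam)) := by positivity
  obtain ⟨C, δ, hC, hδ, H⟩ := nextScale_hessian_lipschitz_of_floor (d := d) a ha.le hm0 hγ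
  exact ⟨C, δ, hC, hδ, fun n s _ V₁ V₂ hV₁ hV₂ hV₁' hV₂' D hD ψ₁ ψ₂ hψ₁ hψ₂ y y' =>
    H n s V₁ V₂ hV₁ hV₂ D hD ψ₁ ψ₂ hψ₁ hψ₂ (coarse_floor n a s ha (by linarith) hLam V₁ hV₁ hV₁' ψ₁ hψ₁)
      (coarse_floor n a s ha (by linarith) hLam V₂ hV₂ hV₂' ψ₂ hψ₂) y y'⟩

/-! ## §3. Toy -/

/-- Toy (`d = 0`, `a = 1`, `λ = 0`, `Λ = 0`): the headline's hypotheses are inhabited, so the constants exist. -/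
example : ∃ C δ : ℝ, 0 < C ∧ 0 < δ :=
  let ⟨C, δ, hC, hδ, _⟩ := nextScale_hessian_lipschitz (d := 0) 1 one_pos (lam := 0) (Lam := 0) (by norm_num) le_rfl; ⟨C, δ, hC, hδ⟩

end Summit.QuantumFields.BalabanUV.T4Continuum.NE7b.SupTorusNextScaleModulus
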